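import Literature.IUT.LogThetaLattice.GlobalLGPFrobenioidsRealifiedPlacesNormalizedDefs
import Literature.IUT.LogThetaLattice.GlobalLGPFrobenioidsModFrakArithDegree
import Literature.IUT.HodgeTheaters.GlobalFrobenioidsRealifyRlfDegree
import HarnessLib

/-!
# [IUTchIII] Ex. 3.6 (ii) / Prop. 3.9 (iii) degree of the categorical `(†𝓕⊛ℝ_𝔪𝔬𝔡)_α` read in [IUTchI] Ex. 3.5 (i)'s
# coordinates `log⊢_mod(p_v) ↦ 1` through the `e_v`-NORMALISED places dictionary (PROOF-ONLY)

S. Mochizuki, *Inter-universal Teichmüller theory III*, Example 3.6 (ii) p. 108 ("the arithmetic line bundle …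
determined by `𝔍`"), Prop. 3.9 (iii) p. 117 ("is equal to the degree of the arithmetic line bundle determined by `𝔍`")
[claim key Mochizuki2012, status disputed (D-0012)]; *Inter-universal Teichmüller theory I*, §3, Example 3.5 (i), kurims
manuscript (May 2020) p. 84 ("the submonoid `Φ_{𝒞⊩_mod,v}` … is naturally isomorphic to `ord(𝒪^▷_{(F_mod)_v})^pf ⊗ ℝ_{≥0}`",
"`p_v` determines an element `log⊢_mod(p_v) ∈ Φ_{𝒞⊩_mod,v}`"); S. Mochizuki, *The geometry of Frobenioids I*, Kyushu J.
Math. **62** (2008), Ex. 6.3 p. 113 (`deg^arith_L`), Thm. 6.4 (i) p. 115 [cite: MochizukiFrdI2008, Ex. 6.3 p.113].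

PROOF-ONLY (abc-iut cell, merge debt LC-L5-1 ↔ layer L6, degree level; abc-iut-w4-d073 gen 5; no `def`, no instance).
Three degree conventions of the cell for the divisor monoid `Φ_{𝒞⊩_mod} = Φ^ℝ(∗)` of the global realified Frobenioid now
provably agree:
(L1) abc-iut-L1's `arithDegree F ∘ toArithDivisor` on `Φ(F)` ([FrdI] Ex. 6.3);
(L5) the weighted-sum functional `f ↦ Σ_v f_v · w_v` on abc-iut-L5-t2's coordinates `(V(F) →₀ ℝ_{≥0})`, `w_v = e_v · log N(v)`
     (finite `v`; the arithmetic degree of `ord_v(p_v)·[v]`, the divisor behind the unit `log⊢_mod(p_v) ↦ 1`) resp.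
     `w_v = [F_v : ℝ]` (archimedean) — `Literature.IUT.HodgeTheaters.arithDegree_toArithDivisor_eq_sum_realifyMod`;
(L6) abc-iut-L6-d3's `GlobalFrobenioidModels.frakDeg` (`𝒪(−D)` sign convention) on the objects of the categorical model.
This file proves the (L6) ↔ (L5) leg through abc-iut-w5-d153's `e_v`-normalised dictionary
`Prop37.FrakRlfCat.effDivAddEquivValNorm F : Φ^ℝ(∗) ≃+ (V(F) →₀ ℝ_{≥0})` (the repair of finding F-w4d073g4-1):

* **`Prop37.frakDeg_effDiv_eq_neg_sum_effDivAddEquivValNorm`** — for EVERY effective realified divisor `X ∈ Φ^ℝ(∗)` (real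
  coefficients), `frakDeg X = − Σ_v (effDivAddEquivValNorm X)_v · w_v` (direct coordinate computation: abc-iut-L6-d3's
  `frakDivisor` / abc-iut LogVolume's `degF` versus the dictionary's `coe_effDivAddEquivVal_apply`, `…Norm_apply_inl/_inr`);
* `Prop37.frakDeg_realifyEff_eq_neg_sum_effDivAddEquivValNorm` — the same for the realification of an INTEGRAL family,
  obtained independently by composing abc-iut-w4-d015's `frakDeg_realifyEff` (`= − deg^arith`), the (L1) ↔ (L5) identity and
  `effDivAddEquivValNorm_realifyEff_effDivOfArith` (`= realifyMod`) — a consistency check of the three files.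
No new Prop fact; no statement of the paper is strengthened; nothing here asserts a disputed claim or takes a side on
[IUTchIII] Cor. 3.12; typed ≠ discharged.
-/

noncomputable section

open scoped Classical NNReal

namespace Literature.IUT.LogThetaLattice

namespace Prop37

open NumberField IsDedekindDomain GlobalFrobenioidModels Literature.AlgebraicGeometry.Frobenioids
  Literature.IUT.HodgeTheaters Literature.IUT.LogVolume

variable (F : Type) [Field F] [NumberField F]

/-- **`frakDeg X = − Σ_v (effDivAddEquivValNorm X)_v · w_v` for every `X ∈ Φ^ℝ(∗)`**: abc-iut-L6-d3's degree of an
effective realified divisor of the categorical `(†𝓕⊛ℝ_𝔪𝔬𝔡)_α` ([IUTchIII] Ex. 3.6 (ii) / Prop. 3.9 (iii), `𝒪(−D)`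
convention), read through the `e_v`-normalised dictionary in abc-iut-L5-t2's coordinates `log⊢_mod(p_v) ↦ 1` of [IUTchI]
Ex. 3.5 (i), is minus the weighted sum with weights `e_v · log N(v)` (finite `v`) / `[F_v : ℝ]` (archimedean `v`).
Proof: place by place — at an archimedean `w` both coordinates are the class `x_w`, with weight `[F_w:ℝ]` on both sides;
at a finite `v` abc-iut-L6-d3's coordinate `x_v` (weight `log N(v)`) is `e_v ·` the normalised one (weight
`e_v · log N(v)`). [claim: Mochizuki2012, status: disputed] -/
theorem frakDeg_effDiv_eq_neg_sum_effDivAddEquivValNorm (X : effDiv (ModelPlaces F) (fun _ => ℝ) nonnegModel) :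
    frakDeg (X : FrakObj (ModelPlaces F) (fun _ => ℝ)) =
      -((FrakRlfCat.effDivAddEquivValNorm F X).sum fun v t => (t : ℝ) *
          Sum.elim (fun w : InfinitePlace F => (w.mult : ℝ))
            (fun w : FinitePlace F => (absRamIdx F w : ℝ) * Real.log (Ideal.absNorm w.maximalIdeal.asIdeal : ℝ)) v) := by
  -- the weights
  let W : Val F → ℝ := Sum.elim (fun w : InfinitePlace F => (w.mult : ℝ))
    (fun w : FinitePlace F => (absRamIdx F w : ℝ) * Real.log (Ideal.absNorm w.maximalIdeal.asIdeal : ℝ))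
  have hWl : ∀ w : InfinitePlace F, W (Sum.inl w) = (w.mult : ℝ) := fun _ => rfl
  have hWr : ∀ w : FinitePlace F,
      W (Sum.inr w) = (absRamIdx F w : ℝ) * Real.log (Ideal.absNorm w.maximalIdeal.asIdeal : ℝ) := fun _ => rfl
  -- the right-hand summand as a function of the place
  let g : Val F → ℝ := fun q => ((FrakRlfCat.effDivAddEquivValNorm F X q : ℝ≥0) : ℝ) * W q
  have hg : ∀ q, g q = ((FrakRlfCat.effDivAddEquivValNorm F X q : ℝ≥0) : ℝ) * W q := fun _ => rfl
  -- the place dictionary `Place F ≃ V(F)` (swap, then abc-iut-w5-d153's `modelPlacesEquivVal`)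
  let e : Place F ≃ Val F := (Equiv.sumComm _ _).trans (FrakRlfCat.modelPlacesEquivVal F)
  have he_inl : ∀ w : InfinitePlace F, e (Sum.inl w) = Sum.inl w := fun _ => rfl
  have he_inr : ∀ v : HeightOneSpectrum (𝓞 F), e (Sum.inr v) = Sum.inr (FinitePlace.mk v) := fun _ => rfl
  -- place by place
  have hpt : ∀ p : Place F,
      frakDivisor (X : FrakObj (ModelPlaces F) (fun _ => ℝ)) p * degWeight F p = -g (e p) := by
    intro p
    rcases p with w | v
    · rw [he_inl, hg, hWl, frakDivisor_apply, Sum.swap_inl, placeMult_inl, degWeight_inl, mul_one,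
        FrakRlfCat.effDivAddEquivValNorm_apply_inl, FrakRlfCat.coe_effDivAddEquivVal_apply,
        FrakRlfCat.modelPlacesEquivVal_symm_apply, mul_comm]
      rfl
    · rw [he_inr, hg, hWr, frakDivisor_apply, Sum.swap_inr, placeMult_inr, degWeight_inr, one_mul,
        FrakRlfCat.effDivAddEquivValNorm_apply_inr, NNReal.coe_mul, NNReal.coe_inv, NNReal.coe_natCast,
        FrakRlfCat.coe_effDivAddEquivVal_apply, FrakRlfCat.modelPlacesEquivVal_symm_apply]
      have he : (absRamIdx F (FinitePlace.mk v) : ℝ) ≠ 0 :=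
        Nat.cast_ne_zero.mpr (absRamIdx_pos F (FinitePlace.mk v)).ne'
      change -((X : FrakObj (ModelPlaces F) (fun _ => ℝ)).cls (Sum.inl v)) * logNorm F v =
        -((absRamIdx F (FinitePlace.mk v) : ℝ)⁻¹ *
            (X : FrakObj (ModelPlaces F) (fun _ => ℝ)).cls (Sum.inl (FinitePlace.mk v).maximalIdeal) *
          ((absRamIdx F (FinitePlace.mk v) : ℝ) * Real.log (Ideal.absNorm (FinitePlace.mk v).maximalIdeal.asIdeal : ℝ)))
      rw [FinitePlace.maximalIdeal_mk, mul_comm _⁻¹, mul_assoc, ← mul_assoc _⁻¹, inv_mul_cancel₀ he, one_mul, neg_mul]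
      rfl
  -- both sides as `finsum`s over all places
  have hL : frakDeg (X : FrakObj (ModelPlaces F) (fun _ => ℝ)) =
      ∑ᶠ p : Place F, frakDivisor (X : FrakObj (ModelPlaces F) (fun _ => ℝ)) p * degWeight F p := by
    rw [frakDeg, degF_apply, Finsupp.sum, finsum_eq_finsetSum_of_support_subset]
    exact (Function.support_mul_subset_left _ _).trans fun p hp => by simpa [Finsupp.mem_support_iff] using hp
  have hR : ((FrakRlfCat.effDivAddEquivValNorm F X).sum fun v t => (t : ℝ) * W v) = ∑ᶠ q : Val F, g q := by
    rw [Finsupp.sum, finsum_eq_finsetSum_of_support_subset]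
    intro q hq
    rw [Finset.mem_coe, Finsupp.mem_support_iff]
    intro h0
    apply hq
    change ((FrakRlfCat.effDivAddEquivValNorm F X q : ℝ≥0) : ℝ) * W q = 0
    rw [h0, NNReal.coe_zero, zero_mul]
  rw [hL, hR, finsum_congr hpt, finsum_neg_distrib, finsum_comp_equiv (f := g)]

/-- **The same for the realification of an INTEGRAL family `D ∈ Φ(∗)`, by composition of the three cell files**:
abc-iut-w4-d015's `frakDeg_realifyEff` (`frakDeg (realifyEff D) = − deg^arith(D)`, [FrdI] Ex. 6.3 / Thm. 6.4 (i)),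
the (L1) ↔ (L5) identity `arithDegree_toArithDivisor_eq_sum_realifyMod`, and abc-iut-w5-d153's
`effDivAddEquivValNorm_realifyEff_effDivOfArith` (`= realifyMod` along `Φ(F) → Φ(∗) → Φ^ℝ(∗)`) — consistent with (and a
special case of) `frakDeg_effDiv_eq_neg_sum_effDivAddEquivValNorm`. [claim: Mochizuki2012, status: disputed] -/
theorem frakDeg_realifyEff_eq_neg_sum_effDivAddEquivValNorm (D : effDiv (Places F) (Gamma F) (nonneg F)) :
    frakDeg (realifyEff F D : FrakObj (ModelPlaces F) (fun _ => ℝ)) =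
      -((FrakRlfCat.effDivAddEquivValNorm F (realifyEff F D)).sum fun v t => (t : ℝ) *
          Sum.elim (fun w : InfinitePlace F => (w.mult : ℝ))
            (fun w : FinitePlace F => (absRamIdx F w : ℝ) * Real.log (Ideal.absNorm w.maximalIdeal.asIdeal : ℝ)) v) := by
  rw [frakDeg_realifyEff, arithDegree_toArithDivisor_eq_sum_realifyMod,
    ← FrakRlfCat.effDivAddEquivValNorm_realifyEff_effDivOfArith, ← effDivAddEquivArith_symm_apply,
    AddEquiv.symm_apply_apply]

end Prop37

end Literature.IUT.LogThetaLattice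

end
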